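import Summits.CriticalPhenomena.Ising3DConformalLimit.Theses.MonotoneRG
import Summits.CriticalPhenomena.Ising3DConformalLimit.Theorems.ExistsScaleCovariantLimit.Negative.DyadicIdentity
import Mathlib.Topology.Order.MonotoneConvergence
import HarnessLib

/-!
# `UniformRegularity ∧ ZoomMonotone` ⟹ the pinned zoom converges at every `b`-adic rational configuration
(route `MonotoneRG`, glue item stmt-CriticalPhenomena-14455 `ZoomGlue`; line `Sketch` of the crux
`ExistsScaleCovariantLimit`, item stmt-CriticalPhenomena-1981 — first half)

Write `F_n(δ)(x) = ρ_pin(δ)ⁿ ⟨∏ σ_{[xᵢ/δ]}⟩_{β_c}` for the pinned zoom of the critical `ℤ³` correlators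
(`ρ_pin(δ) = ⟨σ₀σ_{⌊1/δ⌋e₀}⟩^{-1/2}`, which IS the forced renormalisation `ρ★` of route `MonotoneRG`,
inlined rewrite `⌊δ⁻¹⌋ = ⌊1/δ⌋`). Under the two cruxes of route `MonotoneRG` read as hypotheses —
`UniformRegularity` (item 4658: uniform local bounds, asymptotic equicontinuity, two-point lower bounds) and
`ZoomMonotone` (item 14454: for every INTEGER non-coincident configuration `y`, `m ↦ F_n(1/m)(y)` is eventually
monotone) — we prove:
* `tendsto_intMesh`: `m ↦ F_n(1/m)(y)` CONVERGES for integer `y` (eventually monotone + bounded);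
* `tendsto_geomMesh_bAdic`: for every integer `b ≥ 1`, every `a` and every integer configuration `y` with
  `x = b^{-a}·y` non-coincident, the zoom along the geometric meshes `b^{-k}` converges AT `x`: by the exact
  re-pinning identity `F_n(δ/s)(x) = F₂(δ)(0,se₀)^{-n/2} F_n(δ)(s·x)` (`pz_scale`, `s = b^a`) it is a
  product of two convergent integer-mesh sequences, the first factor tending to a POSITIVE limit by the
  two-point lower bound (c).
The second half (`…MonotoneRGZoomGlue.lean`) turns this pointwise convergence on the dense `2`-adic and
`3`-adic rationals into uniqueness of the (continuous) cluster points of the dyadic and triadic pinned zooms,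
hence — by the two-hierarchies theorems of line `Sketch` — into the crux.

References: folklore real analysis (monotone convergence); M. W. Hirsch, H. Smith, *Monotone dynamical
systems* (2005) Thm 1.4 for the reading of `ZoomMonotone`. No definitions are introduced.
-/

noncomputable section

namespace Summit.CriticalPhenomena.Ising3DConformalLimit.MonotoneRGZoomGlue

open Literature.Probability.LatticeModels Filter Set
open scoped Topology
open Summit.CriticalPhenomena.Ising3DConformalLimit.MoebiusLimitExistsOnlyInteraction (rhoPin)
open Summit.CriticalPhenomena.Ising3DConformalLimit.ExistsScaleCovariantLimitNegative.Dyadic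
open Summit.CriticalPhenomena.Ising3DConformalLimit.Theses.MonotoneRG (UniformRegularity ZoomMonotone)

/-! (The forced renormalisation `ρ★(δ) = ⟨σ₀σ_{⌊δ⁻¹⌋e₀}⟩^{-1/2}` of route `MonotoneRG` IS the pinned one,
`rhoPin`, since `⌊δ⁻¹⌋ = ⌊1/δ⌋`; the tree records this as `…RescaledBounds.rhoStar_eq_rhoPin`, whose module we
do not import — the one-line rewrite is inlined below where needed.) -/

/-! ### Integer meshes: eventual monotonicity + bounds ⟹ convergence -/

/-- A real sequence that is eventually monotone or eventually antitone, and eventually bounded in absolute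
value, converges. [folklore] -/
theorem tendsto_of_eventually_monotone_of_bounded {f : ℕ → ℝ} {m₀ : ℕ}
    (hmono : MonotoneOn f (Set.Ici m₀) ∨ AntitoneOn f (Set.Ici m₀))
    {M : ℝ} (hbd : ∀ᶠ m in atTop, |f m| ≤ M) :
    ∃ L : ℝ, Tendsto f atTop (𝓝 L) := by
  -- the shifted sequence `g j = f (j + m₀)` is monotone / antitone
  set g : ℕ → ℝ := fun j => f (j + m₀) with hg
  have hbd' : ∀ᶠ j in atTop, |g j| ≤ M := (tendsto_add_atTop_nat m₀).eventually hbd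
  have not_top : ¬ Tendsto g atTop atTop := by
    intro h
    obtain ⟨j, hj1, hj2⟩ := ((h.eventually_gt_atTop M).and hbd').exists
    exact absurd (lt_of_lt_of_le hj1 (le_abs_self _)) (not_lt.2 hj2)
  have not_bot : ¬ Tendsto g atTop atBot := by
    intro h
    obtain ⟨j, hj1, hj2⟩ := ((h.eventually_lt_atBot (-M)).and hbd').exists
    have := neg_abs_le (g j)
    linarith
  have hL : ∃ L : ℝ, Tendsto g atTop (𝓝 L) := by
    rcases hmono with hm | ha
    · have hgm : Monotone g := fun i j hij => hm (by simp) (by simp) (by simpa using hij)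
      exact (tendsto_atTop_of_monotone hgm).resolve_left not_top
    · have hga : Antitone g := fun i j hij => ha (by simp) (by simp) (by simpa using hij)
      exact (tendsto_atTop_of_antitone hga).resolve_left not_bot
  obtain ⟨L, hL⟩ := hL
  exact ⟨L, (tendsto_add_atTop_iff_nat m₀).1 hL⟩

/-- `1/m → 0⁺` along the positive integers (as a statement about `m : ℕ → 1/(m:ℝ)` at `atTop`). [folklore] -/
theorem tendsto_one_div_natCast : Tendsto (fun m : ℕ => 1 / (m : ℝ)) atTop (𝓝[>] (0:ℝ)) := by
  refine tendsto_nhdsWithin_iff.2 ⟨tendsto_one_div_atTop_nhds_zero_nat, ?_⟩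
  filter_upwards [eventually_gt_atTop 0] with m hm
  exact Set.mem_Ioi.2 (by positivity)

/-- Eventually `1/m ∈ (0, δ₀)`. [folklore] -/
theorem eventually_one_div_mem_Ioo {δ₀ : ℝ} (hδ₀ : 0 < δ₀) :
    ∀ᶠ m : ℕ in atTop, 1 / (m : ℝ) ∈ Set.Ioo 0 δ₀ := by
  have h := tendsto_one_div_natCast (Ioo_mem_nhdsGT hδ₀)
  exact h

/-- **Local bound at a point** (clause (a) of `UniformRegularity` on `K = {x}`): `|F_n(1/m)(x)| ≤ M`
for all large `m`. [folklore] -/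
theorem eventually_abs_le_of_UR (hUR : UniformRegularity) {n : ℕ} {x : Fin n → EuclideanSpace ℝ (Fin 3)}
    (hx : x ∈ NonCoincident 3 n) :
    ∃ M : ℝ, ∀ᶠ m : ℕ in atTop, |rescaledCorrelator (criticalCorr 3) rhoPin n (1 / (m : ℝ)) x| ≤ M := by
  obtain ⟨M, δ₀, hδ₀, hM⟩ :=
    (hUR.1 n {x} (Set.singleton_subset_iff.2 hx) isCompact_singleton).1
  have hρ : (fun δ : ℝ => (criticalTwoPoint 3 (Pi.single 0 ⌊δ⁻¹⌋)) ^ (-(1/2:ℝ))) = rhoPin :=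
    funext fun δ => by simp only [rhoPin, one_div]
  refine ⟨M, ?_⟩
  filter_upwards [eventually_one_div_mem_Ioo hδ₀] with m hm
  have h := hM _ hm x (Set.mem_singleton x)
  rwa [hρ] at h

/-- **Two-point lower bound at a pair** (clause (c) of `UniformRegularity` on `K = {x}`): `c ≤ F₂(1/m)(x)`
for all large `m`, some `c > 0`. [folklore] -/
theorem eventually_le_two_of_UR (hUR : UniformRegularity) {x : Fin 2 → EuclideanSpace ℝ (Fin 3)}
    (hx : x ∈ NonCoincident 3 2) :
    ∃ c : ℝ, 0 < c ∧ ∀ᶠ m : ℕ in atTop, c ≤ rescaledCorrelator (criticalCorr 3) rhoPin 2 (1 / (m : ℝ)) x := by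
  obtain ⟨c, δ₀, hc, hδ₀, hcm⟩ := hUR.2 {x} (Set.singleton_subset_iff.2 hx) isCompact_singleton
  have hρ : (fun δ : ℝ => (criticalTwoPoint 3 (Pi.single 0 ⌊δ⁻¹⌋)) ^ (-(1/2:ℝ))) = rhoPin :=
    funext fun δ => by simp only [rhoPin, one_div]
  refine ⟨c, hc, ?_⟩
  filter_upwards [eventually_one_div_mem_Ioo hδ₀] with m hm
  have h := hcm _ hm x (Set.mem_singleton x)
  rwa [hρ] at h

/-- **Integer configurations: the pinned zoom converges along the integer meshes `1/m`.**
(`ZoomMonotone` = eventual monotonicity; `UniformRegularity` (a) = boundedness.) [folklore] -/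
theorem tendsto_intMesh (hUR : UniformRegularity) (hZM : ZoomMonotone) {n : ℕ}
    {y : Fin n → EuclideanSpace ℝ (Fin 3)} (hy : y ∈ NonCoincident 3 n)
    (hint : ∀ i j, ∃ z : ℤ, y i j = (z : ℝ)) :
    ∃ L : ℝ, Tendsto (fun m : ℕ => rescaledCorrelator (criticalCorr 3) rhoPin n (1 / (m : ℝ)) y)
      atTop (𝓝 L) := by
  obtain ⟨m₀, hmono⟩ := hZM n y hy hint
  have hρ : (fun δ : ℝ => (criticalTwoPoint 3 (Pi.single 0 ⌊δ⁻¹⌋)) ^ (-(1/2:ℝ))) = rhoPin :=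
    funext fun δ => by simp only [rhoPin, one_div]
  rw [hρ] at hmono
  obtain ⟨M, hM⟩ := eventually_abs_le_of_UR hUR hy
  exact tendsto_of_eventually_monotone_of_bounded hmono hM

/-- The limit of the pinned PAIR zoom at an integer pair is positive. [folklore] -/
theorem tendsto_intMesh_two_pos (hUR : UniformRegularity) (hZM : ZoomMonotone)
    {y : Fin 2 → EuclideanSpace ℝ (Fin 3)} (hy : y ∈ NonCoincident 3 2)
    (hint : ∀ i j, ∃ z : ℤ, y i j = (z : ℝ)) :
    ∃ L : ℝ, 0 < L ∧ Tendsto (fun m : ℕ => rescaledCorrelator (criticalCorr 3) rhoPin 2 (1 / (m : ℝ)) y)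
      atTop (𝓝 L) := by
  obtain ⟨L, hL⟩ := tendsto_intMesh hUR hZM hy hint
  obtain ⟨c, hc, hcm⟩ := eventually_le_two_of_UR hUR hy
  exact ⟨L, lt_of_lt_of_le hc (ge_of_tendsto hL hcm), hL⟩

/-- Along the geometric meshes `b^{-j}` (`b ≥ 2`) an integer-mesh convergent sequence still converges:
`b^{-j} = 1/(b^j)` and `j ↦ b^j → ∞`. [folklore] -/
theorem tendsto_geomMesh_of_intMesh {b : ℕ} (hb : 2 ≤ b) {g : ℝ → ℝ} {L : ℝ}
    (h : Tendsto (fun m : ℕ => g (1 / (m : ℝ))) atTop (𝓝 L)) :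
    Tendsto (fun j : ℕ => g (((b : ℝ) ^ j)⁻¹)) atTop (𝓝 L) := by
  have hpow : Tendsto (fun j : ℕ => b ^ j) atTop atTop :=
    tendsto_pow_atTop_atTop_of_one_lt (by omega)
  have h' := h.comp hpow
  refine h'.congr fun j => ?_
  simp [one_div]

/-- The axis pair `(0, s e₀)` has integer coordinates when `s` is a natural number. [folklore] -/
theorem cfg0_natCast_int (s : ℕ) :
    ∀ i j, ∃ z : ℤ, (![0, EuclideanSpace.single 0 (s : ℝ)] : Fin 2 → EuclideanSpace ℝ (Fin 3)) i j = (z : ℝ) := by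
  intro i j
  fin_cases i
  · exact ⟨0, by simp⟩
  · by_cases hj : j = 0
    · subst hj
      exact ⟨s, by simp⟩
    · exact ⟨0, by simp [hj]⟩

/-- Dilating a `b`-adic rational configuration `x = (b^a)⁻¹ • y` by `b^a` gives back `y`. [folklore] -/
theorem smul_bAdic {b : ℕ} (hb : 2 ≤ b) (a : ℕ) {n : ℕ} (y : Fin n → EuclideanSpace ℝ (Fin 3)) :
    (fun i => ((b : ℝ) ^ a) • ((((b : ℝ) ^ a)⁻¹ • y i))) = y := by
  funext i
  have hne : ((b : ℝ) ^ a) ≠ 0 := pow_ne_zero _ (by exact_mod_cast (show b ≠ 0 by omega))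
  rw [smul_inv_smul₀ hne]

/-- **`b`-adic rational configurations: the pinned zoom converges along the geometric meshes `b^{-k}`.**
For `x = (b^a)⁻¹ • y` with `y` an integer configuration and `x` non-coincident:
`F_n(b^{-(j+a)})(x) = F₂(b^{-j})(0, b^a e₀)^{-n/2} · F_n(b^{-j})(y)` (`pz_scale`), both factors converge
along `j → ∞` (`tendsto_intMesh` at the integer configurations `y` and `(0, b^a e₀)`), the first to a
positive number, so the product converges; shifting the index by `a` gives the claim. [folklore] -/
theorem tendsto_geomMesh_bAdic (hUR : UniformRegularity) (hZM : ZoomMonotone) {b : ℕ} (hb : 2 ≤ b) (a : ℕ)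
    {n : ℕ} {y : Fin n → EuclideanSpace ℝ (Fin 3)}
    (hint : ∀ i j, ∃ z : ℤ, y i j = (z : ℝ))
    (hx : (fun i => ((b : ℝ) ^ a)⁻¹ • y i) ∈ NonCoincident 3 n) :
    ∃ L : ℝ, Tendsto (fun k : ℕ => rescaledCorrelator (criticalCorr 3) rhoPin n (((b : ℝ) ^ k)⁻¹)
      (fun i => ((b : ℝ) ^ a)⁻¹ • y i)) atTop (𝓝 L) := by
  have hb0 : (0 : ℝ) < b := by exact_mod_cast (show 0 < b by omega)
  have hs : (0 : ℝ) < (b : ℝ) ^ a := pow_pos hb0 a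
  -- `y` itself is non-coincident (it is a dilate of `x`)
  have hy : y ∈ NonCoincident 3 n := by
    have h := smul_mem_nonCoincident hs.ne' hx
    rwa [smul_bAdic hb a y] at h
  -- the two integer-mesh limits
  obtain ⟨L₁, hL₁⟩ := tendsto_intMesh hUR hZM hy hint
  have hcfg : (![0, EuclideanSpace.single 0 ((b : ℝ) ^ a)] : Fin 2 → EuclideanSpace ℝ (Fin 3)) ∈
      NonCoincident 3 2 := cfg0_mem hs.ne'
  obtain ⟨L₂, hL₂pos, hL₂⟩ := tendsto_intMesh_two_pos hUR hZM hcfg (by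
    have h := cfg0_natCast_int (b ^ a)
    push_cast at h
    exact h)
  -- along the geometric meshes
  have hG₁ := tendsto_geomMesh_of_intMesh hb
    (g := fun δ => rescaledCorrelator (criticalCorr 3) rhoPin n δ y) hL₁
  have hG₂ := tendsto_geomMesh_of_intMesh hb
    (g := fun δ => rescaledCorrelator (criticalCorr 3) rhoPin 2 δ
      (![0, EuclideanSpace.single 0 ((b : ℝ) ^ a)] : Fin 2 → EuclideanSpace ℝ (Fin 3))) hL₂
  -- the product converges
  have hprod : Tendsto (fun j : ℕ =>
      (rescaledCorrelator (criticalCorr 3) rhoPin 2 (((b : ℝ) ^ j)⁻¹)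
        (![0, EuclideanSpace.single 0 ((b : ℝ) ^ a)] : Fin 2 → EuclideanSpace ℝ (Fin 3))) ^ (-(n:ℝ) / 2) *
      rescaledCorrelator (criticalCorr 3) rhoPin n (((b : ℝ) ^ j)⁻¹) y) atTop
      (𝓝 (L₂ ^ (-(n:ℝ) / 2) * L₁)) :=
    (hG₂.rpow_const (Or.inl hL₂pos.ne')).mul hG₁
  -- the exact re-pinning identity at the shifted index `j + a`
  have hid : ∀ j : ℕ, rescaledCorrelator (criticalCorr 3) rhoPin n (((b : ℝ) ^ (j + a))⁻¹)
      (fun i => ((b : ℝ) ^ a)⁻¹ • y i) =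
      (rescaledCorrelator (criticalCorr 3) rhoPin 2 (((b : ℝ) ^ j)⁻¹)
        (![0, EuclideanSpace.single 0 ((b : ℝ) ^ a)] : Fin 2 → EuclideanSpace ℝ (Fin 3))) ^ (-(n:ℝ) / 2) *
      rescaledCorrelator (criticalCorr 3) rhoPin n (((b : ℝ) ^ j)⁻¹) y := by
    intro j
    have h := pz_scale (s := (b : ℝ) ^ a) hs (by positivity : (0:ℝ) < ((b : ℝ) ^ j)⁻¹) n
      (fun i => ((b : ℝ) ^ a)⁻¹ • y i)
    have e : ((b : ℝ) ^ a)⁻¹ * ((b : ℝ) ^ j)⁻¹ = ((b : ℝ) ^ (j + a))⁻¹ := by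
      rw [pow_add, mul_inv, mul_comm]
    rw [e] at h
    rw [h]
    congr 2
    exact smul_bAdic hb a y
  refine ⟨L₂ ^ (-(n:ℝ) / 2) * L₁, (tendsto_add_atTop_iff_nat a).1 ?_⟩
  exact hprod.congr fun j => (hid j).symm

end Summit.CriticalPhenomena.Ising3DConformalLimit.MonotoneRGZoomGlue

end
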